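import Literature.IUT.HodgeTheaters.InitialThetaDataPlaces
import Literature.NumberTheory.EllipticCurves.NeronModelProofs
import Summits.ABC.IUTFork.LanaDegreesBridge
import HarnessLib

/-!
# L-LANA objects VIII ter: the `q`-pilot input of LANA §4.2 (c) FROM [IUTchI] Def. 3.1 initial Θ-data (N7 made real)

Record-only file (D-0012) of the abc-iut cell (seat abc-iut-c312-4, L-LANA level, plan/LLANA-SPEC N7; CONSUMES
layer L5's REAL `Literature.IUT.HodgeTheaters.InitialThetaData` = [IUTchI] Def. 3.1 (a)–(f), seat abc-iut-L5-t2,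
and its place API `InitialThetaDataPlaces`); TAKES NO SIDE on [IUTchIII] Cor. 3.12.

LANA §4.2 (c) p. 26: "For each `v ∈ V^bad`, let us write one of the `2l`-th roots of `q_v` introduced in §1.1 as
`q̲_v`. For an element `a ∈ O_{F_v}`, we define `deg(a) := [F:ℚ]⁻¹ log(#(O_{F_v}/aO_{F_v}))`. Using this, one can
construct a value-group BPS as follows: • put `C := ℝ`; • for each `v ∈ V`, define the local pilot `φ_v ∈ C`
by `φ_v = deg(q̲_v)` (`v ∈ V^bad`); `deg(p_v)` (`v ∈ V^good ∩ V^non`); `2π` (`v ∈ V^arc`)."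
`LanaDegrees.lean` (gen 0) DEFINED these degrees over a number field and packaged the arithmetic input as
`QPilotInput F` (`l ≥ 5`, `V^bad ≠ ∅`, `ord_v(q_v) > 0` on `V^bad`), leaving the input itself ABSTRACT
(RESIDUAL-LANA N7: "`ordq` … `QPilotInput.ofInitialThetaData`"). THIS file builds it from initial Θ-data
`D : InitialThetaData F K F̄ E l P`:

* `InitialThetaData.badPrimes D` — `V(F)^bad` ([IUTchI] Def. 3.1 (b)/(c): the places of `F` over `V^bad_mod`)
  as a FINITE set of primes of `𝓞 F` (finiteness = L5's `VFbad_finite`), NONEMPTY (`badPrimes_nonempty`: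
  `V^bad_mod ≠ ∅` + surjectivity of `V(F) ↠ V_mod`, L5 `Val.restrict_surjective`);
* `hasMultiplicativeReductionAt_of_mem_badPrimes` (Def. 3.1 (b) "`X_F` has bad [i.e., multiplicative]
  reduction at the elements of `V(F)` that lie over `V^bad_mod`"), hence **`qParamOrd_pos_of_mem_badPrimes`:
  `ord_v(q_v) > 0` on `V(F)^bad`** — the one arithmetic input `QPilotInput.ordq_pos` asks for, PROVED from the
  tree's `WeierstrassCurve.ordMinimalDiscriminant_ne_zero_of_hasMultiplicativeReductionAt` (Silverman AEC
  VII.5.1 (b), kernel theorem of the elliptic-curve trunk); and `l_coprime_qParamOrd_of_mem_badPrimes`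
  (Def. 3.1 (c) "`l` is prime … to the orders of the `q`-parameters of `E_F`");
* **`QPilotInput.ofInitialThetaData D S`** — the `q`-pilot input of the étale Hodge theater of `D`:
  `l := l`, `V^bad := V(F)^bad`, `ord_v(q_v) := qParamOrd E v` (L5: `= ord_v(Δ_min)`, Tate uniformisation as
  FACT there), the good finite places TRUNCATED to a chosen finite set `S` and `#V^arc := #`(infinite places
  of `F`); whence (`LanaDegreesBridge`) the skeleton-XIV `LocalDegrees`, both pilot BPSs, the Θ-link's
  value-group portion and LANA §10.5's non-commuting hexagon FOR THE CURVE OF THE INITIAL Θ-DATA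
  (`hexagon_not_commute_thetaData`).

Modelling notes (honest scope). (i) LANA indexes the pilots by `V = V̲ ⊆ V(K)` (Def. 2.5.1 p. 13, a section of
`V(K) ↠ V_mod`) while printing `deg` with `O_{F_v}` and `[F:ℚ]` (p. 26); this file works at the level of the
places of `F` (the field of definition of `E_F`, [IUTchI] Def. 3.1 (b)), where `ord_v(q_v)` is the quantity
Def. 3.1 (c) itself names ("the orders of the `q`-parameters of `E_F` … at the primes of `V(F)^bad`"). The
`K_v̲`-level order is `e(v̲|v)·ord_v(q_v)` (base change of multiplicative reduction along `K/F`) — not here.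
(ii) `QPilotInput` (gen 0) carries FINITELY many good places (`[Fintype V]` in skeleton XIII/XIV), whereas
`V_mod` is infinite (L5 `InitialThetaData.V_infinite`, `isEmpty_fintype_V`): the parameter `S` is exactly the
truncation L5's docstring prescribes ("every TRUNCATION `V̲_S` … to a finite `S ⊆ V_mod`"); the pilot
`φ_C = Σ_{v ∈ V^bad} φ_v` (Def. 4.1.3) does not see `S`. (iii) `2l`-th roots: `deg(q̲_v) = ord_v(q_v)/(2l)·deg(π_v)`
is gen-0's `qPilotBad`. [cite: LANA2026Report, §4.2 (c) p. 26] [claim: Mochizuki2012, status: disputed]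
NOT here: the `K`-level instance; any judgement.
-/

noncomputable section

namespace Summit.ABC
namespace IUTFork

open NumberField IsDedekindDomain
open Literature.IUT.HodgeTheaters (InitialThetaData BadPlacePredicates qParamOrd fieldOfModuli)

universe v w

variable {F : Type} {K : Type v} {Fbar : Type w} [Field F] [NumberField F] [Field K] [NumberField K]
  [Algebra F K] [Field Fbar] [Algebra F Fbar] [Algebra K Fbar] {E : WeierstrassCurve F} [E.IsElliptic]
  {l : ℕ} {P : BadPlacePredicates K} (D : InitialThetaData F K Fbar E l P)

namespace InitialThetaData

/-! ## 1. `V(F)^bad` as a finite, nonempty set of primes of multiplicative reduction -/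

/-- **`V(F)^bad`** ([IUTchI] Def. 3.1 (b): the places of `F` lying over `V^bad_mod`; L5's `VFbad`) as a finite
set of primes of `𝓞 F` (finite by L5's `VFbad_finite`). [claim: Mochizuki2012, status: disputed]
[cite: LANA2026Report, §4.2 (c) p. 26] -/
def badPrimes : Finset (HeightOneSpectrum (𝓞 F)) :=
  (D.VFbad_finite.image FinitePlace.maximalIdeal).toFinset

/-- Membership: `v ∈ V(F)^bad` iff `v` is the prime of a finite place of `F` over `V^bad_mod`.
[claim: Mochizuki2012, status: disputed] -/
theorem mem_badPrimes_iff (v : HeightOneSpectrum (𝓞 F)) :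
    v ∈ badPrimes D ↔ ∃ x ∈ D.VFbad, FinitePlace.maximalIdeal x = v := by
  simp [badPrimes]

/-- A finite place over `V^bad_mod` gives an element of `V(F)^bad`. [claim: Mochizuki2012, status: disputed] -/
theorem maximalIdeal_mem_badPrimes {x : FinitePlace F} (hx : x ∈ D.VFbad) :
    FinitePlace.maximalIdeal x ∈ badPrimes D :=
  (mem_badPrimes_iff D _).mpr ⟨x, hx, rfl⟩

/-- **`V(F)^bad ≠ ∅`**: `V^bad_mod` is nonempty (Def. 3.1 (b)) and every place of `F_mod` lies below a place of
`F` (L5 `Val.restrict_surjective`). [claim: Mochizuki2012, status: disputed] -/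
theorem badPrimes_nonempty : (badPrimes D).Nonempty := by
  obtain ⟨u, hu⟩ := D.VbadMod_nonempty
  obtain ⟨x, hx⟩ := Literature.IUT.HodgeTheaters.Val.restrict_surjective (fieldOfModuli E) (M := F)
    (Literature.IUT.HodgeTheaters.Val.non u)
  rcases x with y | x
  · exact absurd hx Sum.inl_ne_inr
  · refine ⟨FinitePlace.maximalIdeal x, maximalIdeal_mem_badPrimes D ?_⟩
    have hx' : Literature.IUT.HodgeTheaters.Val.restrict (fieldOfModuli E) (Literature.IUT.HodgeTheaters.Val.non x) =
        Literature.IUT.HodgeTheaters.Val.non u := hx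
    show Literature.IUT.HodgeTheaters.Val.restrict (fieldOfModuli E) (Literature.IUT.HodgeTheaters.Val.non x) ∈
      Literature.IUT.HodgeTheaters.Val.non '' D.VbadMod
    rw [hx']
    exact ⟨u, hu, rfl⟩

/-- **Def. 3.1 (b): multiplicative reduction on `V(F)^bad`** ("`X_F` has bad [i.e., multiplicative] reduction
at the elements of `V(F)` that lie over `V^bad_mod`", L5 field `multiplicative_over_VbadMod`).
[claim: Mochizuki2012, status: disputed] -/
theorem hasMultiplicativeReductionAt_of_mem_badPrimes {v : HeightOneSpectrum (𝓞 F)} (hv : v ∈ badPrimes D) :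
    E.HasMultiplicativeReductionAt v := by
  obtain ⟨x, hx, rfl⟩ := (mem_badPrimes_iff D v).mp hv
  exact D.multiplicative_over_VbadMod x hx

/-- **`ord_v(q_v) > 0` on `V(F)^bad`** — the arithmetic input of LANA's `q`-pilot (`QPilotInput.ordq_pos`),
PROVED: multiplicative reduction forces `ord_v(Δ_min) ≥ 1` (Silverman AEC VII.5.1 (b); tree theorem
`WeierstrassCurve.ordMinimalDiscriminant_ne_zero_of_hasMultiplicativeReductionAt`), and L5 defines
`ord_v(q_v) := ord_v(Δ_min)` (`qParamOrd`, Tate uniformisation as FACT). [claim: Mochizuki2012, status: disputed]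
[cite: LANA2026Report, §4.2 (c) p. 26] -/
theorem qParamOrd_pos_of_mem_badPrimes {v : HeightOneSpectrum (𝓞 F)} (hv : v ∈ badPrimes D) :
    0 < qParamOrd E v :=
  Nat.pos_of_ne_zero
    (WeierstrassCurve.ordMinimalDiscriminant_ne_zero_of_hasMultiplicativeReductionAt v E
      (hasMultiplicativeReductionAt_of_mem_badPrimes D hv))

/-- **Def. 3.1 (c) on `V(F)^bad`**: "`l` is prime … to the orders of the `q`-parameters of `E_F`" (L5 field
`l_coprime_qParamOrd`). [claim: Mochizuki2012, status: disputed] -/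
theorem l_coprime_qParamOrd_of_mem_badPrimes {v : HeightOneSpectrum (𝓞 F)} (hv : v ∈ badPrimes D) :
    l.Coprime (qParamOrd E v) := by
  obtain ⟨x, hx, rfl⟩ := (mem_badPrimes_iff D v).mp hv
  exact D.l_coprime_qParamOrd x hx

/-- In particular `l ∤ ord_v(q_v)` on `V(F)^bad` (`l` is prime, Def. 3.1 (c)). [claim: Mochizuki2012, status: disputed] -/
theorem not_l_dvd_qParamOrd_of_mem_badPrimes {v : HeightOneSpectrum (𝓞 F)} (hv : v ∈ badPrimes D) :
    ¬ l ∣ qParamOrd E v := by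
  intro h
  have hcop := l_coprime_qParamOrd_of_mem_badPrimes D hv
  have hl1 : l = 1 := Nat.Coprime.eq_one_of_dvd hcop h
  have := D.five_le_l
  omega

end InitialThetaData

/-! ## 2. The `q`-pilot input of the étale Hodge theater of `D` -/

namespace QPilotInput

/-- **LANA §4.2 (c)'s `q`-pilot input FROM initial Θ-data** ([IUTchI] Def. 3.1): `l`, `V^bad := V(F)^bad`,
`ord_v(q_v) := qParamOrd E v` with `ord_v(q_v) > 0` PROVED, the good finite places truncated to the finite set
`S` (modelling note (ii)), `#V^arc :=` the number of infinite places of `F`.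
[cite: LANA2026Report, §4.2 (c) p. 26] [claim: Mochizuki2012, status: disputed] -/
def ofInitialThetaData (S : Finset (HeightOneSpectrum (𝓞 F))) : QPilotInput F where
  l := l
  five_le := D.five_le_l
  bad := InitialThetaData.badPrimes D
  bad_nonempty := InitialThetaData.badPrimes_nonempty D
  good := S
  nArc := Fintype.card (InfinitePlace F)
  ordq := qParamOrd E
  ordq_pos _ hv := InitialThetaData.qParamOrd_pos_of_mem_badPrimes D hv

variable (S : Finset (HeightOneSpectrum (𝓞 F)))

/-- The prime of the input is the `l` of the initial Θ-data. [cite: LANA2026Report, §4.2 (c) p. 26] -/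
@[simp] theorem ofInitialThetaData_l : (ofInitialThetaData D S).l = l := rfl

/-- `V^bad` of the input is `V(F)^bad`. [cite: LANA2026Report, §4.2 (c) p. 26] -/
@[simp] theorem ofInitialThetaData_bad : (ofInitialThetaData D S).bad = InitialThetaData.badPrimes D := rfl

/-- `ord_v(q_v)` of the input is L5's `qParamOrd E v`. [cite: LANA2026Report, §4.2 (c) p. 26] -/
@[simp] theorem ofInitialThetaData_ordq (v : HeightOneSpectrum (𝓞 F)) :
    (ofInitialThetaData D S).ordq v = qParamOrd E v := rfl

/-- **The local pilot at a bad place is `deg(q̲_v) = ord_v(q_v)/(2l) · deg(π_v)`** with the REAL `ord_v(q_v)` of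
`E_F`. [cite: LANA2026Report, §4.2 (c) p. 26] -/
theorem ofInitialThetaData_d_bad (v : ↥(InitialThetaData.badPrimes D)) :
    (ofInitialThetaData D S).d (Sum.inl (Sum.inl v)) = qPilotBad v.1 l (qParamOrd E v.1) := rfl

/-- The local pilot at a (chosen) good finite place is `deg(p_v)`. [cite: LANA2026Report, §4.2 (c) p. 26] -/
theorem ofInitialThetaData_d_good (v : ↥S) : (ofInitialThetaData D S).d (Sum.inl (Sum.inr v)) = degP v.1 := rfl

/-- The local pilot at an archimedean place is `2π`. [cite: LANA2026Report, §4.2 (c) p. 26] -/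
theorem ofInitialThetaData_d_arc (i : Fin (Fintype.card (InfinitePlace F))) :
    (ofInitialThetaData D S).d (Sum.inr i) = qPilotArc := rfl

/-- **The pilot `φ_C = Σ_{v ∈ V(F)^bad} deg(q̲_v)` of the curve of the initial Θ-data is positive** (Def. 4.1.3's
nonvanishing; gen-0 `pilot_pos` with `ord_v(q_v) > 0` now PROVED). [cite: LANA2026Report, Def. 4.1.3 p. 24, §4.2 (c) p. 26] -/
theorem ofInitialThetaData_pilot_pos :
    0 < ∑ v ∈ (ofInitialThetaData D S).badIn, (ofInitialThetaData D S).d v :=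
  (ofInitialThetaData D S).pilot_pos

/-- `ℓ⋇ = (l − 1)/2` of the associated `LocalDegrees` (XIV). [cite: LANA2026Report, §7.1 (a) p. 37] -/
theorem ofInitialThetaData_lstar : (ofInitialThetaData D S).toLocalDegrees.lstar = (l - 1) / 2 := rfl

/-- **LANA §10.5 for the curve of the initial Θ-data** ("we concur that the diagram in Figure 7 does not
commute"): on the Θ-pilot of the PRINTED degrees of `E_F`, the Θ-side degree `s·Σ_{bad} deg(q̲_v)` differs from
the value transported through the Θ-link, `Σ_{bad} deg(q̲_v)` — skeleton XIV `hexagon_not_commute`, now with NO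
arithmetic hypothesis left (gen-0 `hexagon_not_commute_printed` ∘ `ofInitialThetaData`).
[cite: LANA2026Report, §10.5 p. 49, §10.2 p. 47] [claim: Mochizuki2012, status: disputed] -/
theorem hexagon_not_commute_thetaData :
    let Q := ofInitialThetaData D S
    Q.toLocalDegrees.thetaDeg Q.toLocalDegrees.s_pos (Q.toLocalDegrees.thetaBPS Q.toLocalDegrees.s_pos).pilot ≠
      Q.toLocalDegrees.qDeg ((Q.toLocalDegrees.thetaLink Q.toLocalDegrees.s_pos).toEquiv
        (Q.toLocalDegrees.thetaBPS Q.toLocalDegrees.s_pos).pilot) :=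
  (ofInitialThetaData D S).hexagon_not_commute_printed

end QPilotInput

end IUTFork

end Summit.ABC

end
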